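import Literature.NumberTheory.GaloisRepresentations.LubinTateColemanLevel
import Literature.NumberTheory.GaloisRepresentations.LubinTateColemanZeros
import HarnessLib

/-!
# Coleman's norm operator commutes with the `𝒪_F`-action `h ↦ h ∘ [v]_f`; `g ∘ f ≡ g^q (mod π)`

De Shalit, *Iwasawa theory of elliptic curves with complex multiplication* (1987), Ch. I §2.1–2.3.
The units `𝒰 = lim← U(K_π^{n+1})` of the Lubin–Tate tower are, by Coleman's interpolation theorem
(`LubinTateColemanInterpolation.lean`), the `𝒩`-invariant series `ℳ_f = {g ∈ 𝒪_F⟦X⟧ : 𝒩g = g}`, and the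
Galois group acts on them through `g ↦ g ∘ [κ(σ)]_f` (Cor. 2.3 (iv)). This file proves that `𝒩` is
EQUIVARIANT for this action, so that `ℳ_f` is an `𝒪_Fˣ`-submodule (everything **proved**, `f = πX + X^q`
over any non-archimedean local field `F`):

* `subst_ltSer_sub_pow_mem_coeffIdeal` — **`g ∘ f ≡ g^q (mod π)`** for every `g ∈ 𝒪_F⟦X⟧` (Frobenius;
  de Shalit's `g^φ ∘ f ≡ g^p (mod 𝔭')`, the congruence behind Lemma I.3.3 and Lemmas I.3.10–3.12).
* `exists_perm_ltAct_ltDivPt` — `[v]` permutes the `π`-division points `W_f^1` (`v ∈ 𝒪_Fˣ`).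
* `evalAt_colemanNorm_subst_hom` — `(𝒩(h ∘ [v]))([π] x) = ((𝒩h) ∘ [v])([π] x)` at every point.
* ★ `colemanNorm_subst_hom` — **`𝒩(h ∘ [v]_f) = (𝒩h) ∘ [v]_f`** for `v ∈ 𝒪_Fˣ` (both series agree at the
  generator `ω_{m+1} = [π] ω_{m+2}` of every level, and a series with these zeros is `0`,
  `LubinTateColemanZeros.lean`); hence `colemanNorm_subst_hom_eq_self_of_eq`: **`ℳ_f` is stable under
  `g ↦ g ∘ [v]_f`** (de Shalit 2.3 (iv): `g_{σβ} = g_β ∘ [κσ]`).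

## References

* E. de Shalit, *Iwasawa theory of elliptic curves with complex multiplication* (1987), Ch. I §2.1
  (Proposition (i): Frobenius congruence), §2.3 (iv). [cite: deShalit1987, Ch. I §2.3 (iv)]
* R. Coleman, *Division values in local fields*, Invent. Math. 53 (1979).

## Mathlib reuse

`Equiv.ofBijective`, `Finite.injective_iff_bijective`, `Fintype.prod_equiv`; from the tree:
`LubinTateColeman.lean` (`subst_sub_expand_mem_coeffIdeal`, `pow_sub_expand_mem_coeffIdeal`),
`LubinTateNormOperator.lean` (`evalAt_ltSMul_colemanNorm`), `LubinTateColemanNorm.lean` (`ltDivPt`,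
`exists_eq_ltDivPt`, `ltDivPt_injective`), `LubinTateColemanLevel.lean` (`evalAt_subst_hom`,
`colemanNorm_level_eq`), `LubinTateColemanZeros.lean` (`eq_of_frequently_evalAt_ltSMul_genPt_eq`),
`LubinTateTowerGenerator.lean` (`cohPt`, `ltAct_pi_cohPt_succ`, `inclUnitBall_evalAt`).
-/

noncomputable section

open Filter Topology Polynomial ValuativeRel
open scoped PowerSeries.WithPiTopology

namespace Literature.NumberTheory.GaloisRepresentations

section LocalFieldE

open GaloisRepresentations.IsNonarchimedeanLocalField LubinTate

variable (F : Type*) [Field F] [ValuativeRel F] [TopologicalSpace F] [IsNonarchimedeanLocalField F]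

attribute [local instance] ltNormUniformSpace ltNormIsUniformAddGroup rk1 nF nE fintypeResidueField

variable {F}
variable {π : 𝒪[F]} (hπ : (valuation F).IsUniformizer (π : F))

/-! ### The Frobenius congruence `g ∘ f ≡ g^q (mod π)` -/

include hπ in
/-- **`g ∘ f ≡ g^q (mod π)`** for every `g ∈ 𝒪_F⟦X⟧` (`g ∘ f ≡ g(X^q) ≡ g^q`: `f ≡ X^q (mod π)` and
`a^q ≡ a (mod π)` on `𝒪_F`). [cite: deShalit1987, Ch. I §2.1 Proposition (i) (proof)] -/
theorem subst_ltSer_sub_pow_mem_coeffIdeal (g : PowerSeries (LTCoeff F)) :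
    PowerSeries.subst (ltSer F π) g - g ^ residueFieldCard F ∈ coeffIdeal (Ideal.span {LTCoeff.of F π}) := by
  have hq : residueFieldCard F ≠ 0 := (one_lt_residueFieldCard F).ne_bot
  have e : PowerSeries.subst (ltSer F π) g - g ^ residueFieldCard F =
      (PowerSeries.subst (ltSer F π) g - PowerSeries.expand (residueFieldCard F) hq g) -
        (g ^ residueFieldCard F - PowerSeries.expand (residueFieldCard F) hq g) := by ring
  rw [e]
  exact sub_mem (subst_sub_expand_mem_coeffIdeal (isLTSeries_ltSer π) hq g)
    (pow_sub_expand_mem_coeffIdeal (isLTRing_LTCoeff hπ) hq g)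

/-! ### `[v]` permutes `W_f^1` -/

variable (n : ℕ)

/-- **`[v]_f` permutes the `π`-division points** `W_f^1 = {ω_c}` for a unit `v`.
[cite: deShalit1987, Ch. I §2.3 (iv) (proof)] -/
theorem exists_perm_ltAct_ltDivPt (v : 𝒪[F]ˣ) :
    ∃ τ : 𝓀[F] ≃ 𝓀[F], ∀ c, ltAct hπ n (v : 𝒪[F]) (ltDivPt hπ n c) = ltDivPt hπ n (τ c) := by
  have hex : ∀ c, ∃ c', ltAct hπ n (v : 𝒪[F]) (ltDivPt hπ n c) = ltDivPt hπ n c' := fun c =>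
    exists_eq_ltDivPt hπ n (by
      change ltAct hπ n π (ltAct hπ n (v : 𝒪[F]) (ltDivPt hπ n c)) = 0
      rw [ltAct_comm]
      change ltAct hπ n (v : 𝒪[F]) (ltSMul (maxNilIdeal F (ltField π n)) (isLTRing_LTCoeff hπ)
        (isLTSeries_LTCoeff π) (LTCoeff.of F π) (ltDivPt hπ n c)) = 0
      rw [ltSMul_ltDivPt]
      exact ltSMul_zero _ _ _ _)
  choose τ hτ using hex
  have hinj : Function.Injective τ := by
    intro c c' hcc'
    have h1 : ltAct hπ n (v : 𝒪[F]) (ltDivPt hπ n c) = ltAct hπ n (v : 𝒪[F]) (ltDivPt hπ n c') := by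
      rw [hτ, hτ, hcc']
    have h2 := congrArg (ltAct hπ n ((v⁻¹ : 𝒪[F]ˣ) : 𝒪[F])) h1
    rw [← ltAct_mul, ← ltAct_mul, Units.inv_mul, ltAct_one, ltAct_one] at h2
    exact ltDivPt_injective hπ n h2
  exact ⟨Equiv.ofBijective τ (Finite.injective_iff_bijective.mp hinj), hτ⟩

/-! ### `𝒩` is equivariant -/

/-- **`(𝒩(h ∘ [v]))([π] x) = ((𝒩h) ∘ [v])([π] x)`** at every point `x ∈ 𝔪_{K_π^{n+1}}` (`v` a unit): both
are `∏_c h([v]x [+] ω_c)` after re-indexing `W_f^1` by `[v]`. [cite: deShalit1987, Ch. I §2.3 (iv)] -/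
theorem evalAt_colemanNorm_subst_hom (v : 𝒪[F]ˣ) (h : PowerSeries (LTCoeff F))
    (x : (maxNilIdeal F (ltField π n)).toIdeal) :
    evalAt (maxNilIdeal F (ltField π n)) (ltAct hπ n π x)
        (colemanNorm hπ n (PowerSeries.subst
          (hom (isLTRing_LTCoeff hπ) (isLTSeries_LTCoeff π) (isLTSeries_LTCoeff π) (LTCoeff.of F (v : 𝒪[F]))) h)) =
      evalAt (maxNilIdeal F (ltField π n)) (ltAct hπ n π x)
        (PowerSeries.subst
          (hom (isLTRing_LTCoeff hπ) (isLTSeries_LTCoeff π) (isLTSeries_LTCoeff π) (LTCoeff.of F (v : 𝒪[F])))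
          (colemanNorm hπ n h)) := by
  -- left: `∏_c (h ∘ [v])(x [+] ω_c) = ∏_c h([v]x [+] [v]ω_c)`
  rw [ltAct, evalAt_ltSMul_colemanNorm, evalAt_subst_hom hπ]
  -- right: `(𝒩h)([v][π]x) = (𝒩h)([π][v]x) = ∏_c h([v]x [+] ω_c)`
  have hcomm : ltSMul (maxNilIdeal F (ltField π n)) (isLTRing_LTCoeff hπ) (isLTSeries_LTCoeff π)
      (LTCoeff.of F (v : 𝒪[F])) (ltSMul (maxNilIdeal F (ltField π n)) (isLTRing_LTCoeff hπ)
        (isLTSeries_LTCoeff π) (LTCoeff.of F π) x) =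
      ltSMul (maxNilIdeal F (ltField π n)) (isLTRing_LTCoeff hπ) (isLTSeries_LTCoeff π) (LTCoeff.of F π)
        (ltSMul (maxNilIdeal F (ltField π n)) (isLTRing_LTCoeff hπ) (isLTSeries_LTCoeff π)
          (LTCoeff.of F (v : 𝒪[F])) x) := by
    rw [← mul_ltSMul, ← mul_ltSMul, mul_comm]
  rw [hcomm, evalAt_ltSMul_colemanNorm]
  obtain ⟨τ, hτ⟩ := exists_perm_ltAct_ltDivPt hπ n v
  simp_rw [evalAt_subst_hom hπ, ltSMul_ltAdd]
  have e : ∀ c, ltSMul (maxNilIdeal F (ltField π n)) (isLTRing_LTCoeff hπ) (isLTSeries_LTCoeff π)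
      (LTCoeff.of F (v : 𝒪[F])) (ltDivPt hπ n c) = ltDivPt hπ n (τ c) := hτ
  simp_rw [e]
  exact Fintype.prod_equiv τ _ _ (fun c => rfl)

/-- The inclusion `𝒪_{E₁} → 𝒪_{E₂}` is injective (generic intermediate fields).
[cite: deShalit1987, Ch. I §1.8] -/
private theorem inclUnitBall_injective' {E₁ E₂ : IntermediateField F (AlgebraicClosure F)}
    [FiniteDimensional F E₁] [FiniteDimensional F E₂] (hle : E₁ ≤ E₂) :
    Function.Injective (inclUnitBall (F := F) hle) := by
  intro a b hab
  have h1 := congrArg (fun z : unitBall E₂ => ((z : E₂) : AlgebraicClosure F)) hab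
  exact Subtype.ext (Subtype.ext h1)

/-- The values of `𝒩(h ∘ [v])` and `(𝒩h) ∘ [v]` agree at `ω_{m+1}` as soon as `ω_{m+1} = [π] y` in some
higher level `K_π^{m'+1}` (generic levels: the comparison is done inside `K_π^{m'+1}`).
[cite: deShalit1987, Ch. I §2.3 (iv)] -/
theorem evalAt_cohPt_colemanNorm_subst_hom_of_eq (v : 𝒪[F]ˣ) (h : PowerSeries (LTCoeff F)) {m m' : ℕ}
    (hle : ltField π m ≤ ltField π m') (y : (maxNilIdeal F (ltField π m')).toIdeal)
    (hy : inclPt hle (cohPt hπ m) = ltAct hπ m' π y) :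
    evalAt (maxNilIdeal F (ltField π m)) (cohPt hπ m)
        (colemanNorm hπ n (PowerSeries.subst
          (hom (isLTRing_LTCoeff hπ) (isLTSeries_LTCoeff π) (isLTSeries_LTCoeff π) (LTCoeff.of F (v : 𝒪[F]))) h)) =
      evalAt (maxNilIdeal F (ltField π m)) (cohPt hπ m)
        (PowerSeries.subst
          (hom (isLTRing_LTCoeff hπ) (isLTSeries_LTCoeff π) (isLTSeries_LTCoeff π) (LTCoeff.of F (v : 𝒪[F])))
          (colemanNorm hπ n h)) := by
  apply inclUnitBall_injective' hle
  rw [inclUnitBall_evalAt, inclUnitBall_evalAt, hy, colemanNorm_level_eq hπ n m', colemanNorm_level_eq hπ n m']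
  exact evalAt_colemanNorm_subst_hom hπ m' v h y

/-- ★ **`𝒩(h ∘ [v]_f) = (𝒩h) ∘ [v]_f`** for a unit `v ∈ 𝒪_Fˣ`: Coleman's norm operator commutes with the
`𝒪_Fˣ`-action `h ↦ h ∘ [v]_f` (both sides agree at `ω_{m+1} = [π] ω_{m+2}` for every `m`, and a
non-zero series has only finitely many such zeros). [cite: deShalit1987, Ch. I §2.3 (iv)] -/
theorem colemanNorm_subst_hom (v : 𝒪[F]ˣ) (h : PowerSeries (LTCoeff F)) :
    colemanNorm hπ n (PowerSeries.subst
        (hom (isLTRing_LTCoeff hπ) (isLTSeries_LTCoeff π) (isLTSeries_LTCoeff π) (LTCoeff.of F (v : 𝒪[F]))) h) =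
      PowerSeries.subst
        (hom (isLTRing_LTCoeff hπ) (isLTSeries_LTCoeff π) (isLTSeries_LTCoeff π) (LTCoeff.of F (v : 𝒪[F])))
        (colemanNorm hπ n h) := by
  refine eq_of_frequently_evalAt_ltSMul_genPt_eq hπ (fun m => (cohUnit hπ m : 𝒪[F]))
    (fun m => (cohUnit hπ m).isUnit) (Filter.Frequently.of_forall fun m => ?_)
  exact evalAt_cohPt_colemanNorm_subst_hom_of_eq hπ n v h (ltField_le_succ hπ m) (cohPt hπ (m + 1))
    (ltAct_pi_cohPt_succ hπ m).symm

/-- **`ℳ_f = {g : 𝒩g = g}` is stable under `g ↦ g ∘ [v]_f`** (`v ∈ 𝒪_Fˣ`): the Galois action on the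
norm-coherent units preserves them (de Shalit 2.3 (iv), `g_{σβ} = g_β ∘ [κ(σ)]_f`).
[cite: deShalit1987, Ch. I §2.3 (iv)] -/
theorem colemanNorm_subst_hom_eq_self_of_eq (v : 𝒪[F]ˣ) {g : PowerSeries (LTCoeff F)}
    (hg : colemanNorm hπ n g = g) :
    colemanNorm hπ n (PowerSeries.subst
        (hom (isLTRing_LTCoeff hπ) (isLTSeries_LTCoeff π) (isLTSeries_LTCoeff π) (LTCoeff.of F (v : 𝒪[F]))) g) =
      PowerSeries.subst
        (hom (isLTRing_LTCoeff hπ) (isLTSeries_LTCoeff π) (isLTSeries_LTCoeff π) (LTCoeff.of F (v : 𝒪[F]))) g := by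
  rw [colemanNorm_subst_hom, hg]

end LocalFieldE

end Literature.NumberTheory.GaloisRepresentations
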